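import Summits.BirchSwinnertonDyer.Rank1Residual.X11b.Three.LambdaSupplyWeilValues
import Summits.BirchSwinnertonDyer.Rank1Residual.X11b.Three.LambdaSupplyTwist
import Summits.BirchSwinnertonDyer.Rank1Residual.X11b.Three.LambdaSupplyAvatar
import Summits.BirchSwinnertonDyer.Rank1Residual.X11b.Three.LambdaSupplyRankTwo
import Summits.BirchSwinnertonDyer.Rank1Residual.X11b.Three.LambdaSupplyCharacters
import HarnessLib

/-!
# X11b @ `p = 3`, S24-a (λ-supply), part (F-IIb): ASSEMBLY — the anticyclotomic pair `(λ, r_λ)`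
# from one algebraic Hecke character `Ψ` of the imaginary quadratic field

HONEST FRAMING (cell `b2b-bsdres`, run/shared/lean/b2b/bsd-rank1-residual/, verbatim in every
file): the goal of the cell is to DELETE the COMBINATION-SHAPED residual classes of the
Birch–Swinnerton-Dyer formula for ALL analytic-rank `≤ 1` elliptic curves over `ℚ` — assembled
STRICTLY from published theorems — so that the rank-`≤ 1` remainder becomes exactly the
CONSTRUCTION-SHAPED classes, which are TYPED, NOT attempted. This is not "finishing BSD". Team N8/O2
(X11b at `3`: `3 ‖ N`, `r_an = 1`, `E[3]` irreducible): research route; nothing booked; NO label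
changes; O2 stays OPEN; S24 never "shrinks" the open remainder `(t)` — it reads `(t)` GIVEN `(λ)`
(H45). THEOREMS ONLY; no definition, no fact, no `sorry`.

PROVENANCE: sub-target S24 'λ-SUPPLY SPLIT' (OWNERS R7-59 / R8-4 / R8-14 / R8-16), seat
`b2b-bsdres-x11b3-p7` (gen. 4), with seat p2 (parts (C) `LambdaSupplyTransport`, (B-q)
`LambdaSupplyQuotient`, (A) `LambdaSupplyCharacters`); census
`HOME/b2b-bsdres-x11b3-p7/s24/S24-FEASIBILITY.md`.

## The theorems (`LambdaSupply.exists_lambda_of_character`, `Three.lambdaSupplyAt₃`)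

`K` imaginary quadratic (`[K:ℚ] = 2`, all infinite places complex), `κ : Γ_K ↠ ℤ₃` ANTICYCLOTOMIC,
`ι : ℚ̄₃ ≃ ℂ`, `σ_c ≠ 1` the non-trivial automorphism of `K`, and `Ψ` an ALGEBRAIC Hecke character
of `K` unramified outside `3` whose quotient `Ψ · (Ψ ∘ σ_c)⁻¹` is unitary of infinity type
`(1, -1)` (part (A) supplies such a `Ψ`). THEN there is a pair `(λ, r_λ)` with the six clauses
[08]–[13] of the X11b frame datum: `λ` unitary, of infinity type `(1,-1)`, trivial on `𝕀_ℚ`,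
unramified outside `3`, `r_λ` its `3`-adic avatar, and `r_λ` FACTORS THROUGH `κ`.
**`Three.lambdaSupplyAt₃`** = S24-a VERBATIM (the hypothesis `hsup` of
`HsiehDescent.hsiehFrameResidualAt₃_of_descent`), UNCONDITIONAL: the core theorem fed with part
(A)'s character (`exists_character_quotient_type_one_three`, seat p2) for `σ_c` = complex
conjugation. Consequence (H45 wording): the named residual `HsiehFrameResidualAt₃ W` now READS
`HsiehDescentAt₃ W` GIVEN `(λ)` — `(t)` itself is unchanged and stays OPEN.

## Proof (quotient shape; every step a tree theorem)

`c ∈ Γ_ℚ ∖ Γ_K` with `c² = 1` and its lift `θ` (`IndexTwo.exists_conjHom`); the rank-two basis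
`Φ₀, Φ₁ : Γ_K →ₜ* ℤ₃` (`exists_spanningPair`, (E)); Weil's character `a : Γ_K →* Eˣ` of `Ψ` with
values in a finite `E/ℚ₃` ((F-IIa) `exists_weilValued`); `S` = inertia at `v ∤ 3` and its
`θ`-translates — killed by `a` (Weil + transport (C)), by `Φ₀, Φ₁` (`ℤ₃`-extensions are unramified
outside `3`); the twists `ω, φ′` ((F-I) `exists_twists`): `u = a ω⁻¹ φ′⁻¹`, `g = u/(u∘θ)`
principal-unit-valued, trivial on `ker Φ₀ ∩ ker Φ₁`, anti-invariant; LEMMA Λ′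
(`apply_eq_one_of_anti`, (E)): `g` kills `ker κ`; finite-order Hecke characters `μ_ω, μ_φ′` with
avatars `ω, φ′` ((B) `exists_hecke_of_isOpen_ker`); `Ψ′ = Ψ μ_ω μ_φ′` has avatar `e ∘ (u⁻¹)`
((B-q) `isPAdicAvatarOf_mul`); `λ := Ψ′ · (Ψ′ ∘ σ_c)⁻¹` has avatar `r_λ := e ∘ (u⁻¹ (u⁻¹∘θ)⁻¹)`
((B-q) `isPAdicAvatarOf_mul_galConj_inv_of_finrank_eq_two`), which is `e ∘ g⁻¹`, so it factors
through `κ`; `λ` is trivial on `𝕀_ℚ` (Galois descent), unramified outside `3`, and unitary of type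
`(1,-1)` because `μ (μ∘σ_c)⁻¹` is of finite order.

## References

* [Weil1956] A. Weil, *On a certain type of characters…*, §1–§2 (the `ℓ`-adic avatar).
* [Greenberg1987] R. Greenberg, *Non-vanishing of certain values of `L`-functions*, §2
  (anticyclotomic characters as quotients `Ψ/Ψ∘c`).
* [Washington1997] L. C. Washington, *Introduction to Cyclotomic Fields*, §13.1, Prop. 13.2.
-/

noncomputable section

open scoped NumberField
open NumberField IsDedekindDomain Field Filter Topology Polynomial
  Literature.NumberTheory.GaloisRepresentations Literature.NumberTheory.EllipticCurves
  Literature.NumberTheory.Automorphic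

namespace Summit.BirchSwinnertonDyer.Rank1Residual.X11b.Three.LambdaSupply

variable {K : Type} [Field K] [NumberField K]

/-- **S24-a, core: the anticyclotomic pair `(λ, r_λ)` from one algebraic Hecke character `Ψ`.**
See the module docstring for the statement and the proof.
[cite: Weil1956, §1–§2] [cite: Greenberg1987, §2] [cite: Washington1997, §13.1] -/
theorem exists_lambda_of_character (ι : PadicAlgCl 3 ≃+* ℂ) (κ : ZpExtension K 3)
    (hK : Module.finrank ℚ K = 2) (himag : ∀ w : InfinitePlace K, w.IsComplex)
    (hκ : κ.IsAnticyclotomic) {σc : K ≃ₐ[ℚ] K} (hσc : σc ≠ 1)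
    {Ψ : HeckeCharacter K} (hΨa : Ψ.IsAlgebraic)
    (hΨu : ∀ v : HeightOneSpectrum (𝓞 K), ((3 : ℕ) : 𝓞 K) ∉ v.asIdeal → Ψ.IsUnramifiedAt v)
    (hunit : (Ψ * (HeckeCharacter.galConj σc Ψ)⁻¹).IsUnitary)
    (htype : (Ψ * (HeckeCharacter.galConj σc Ψ)⁻¹).HasInfinityType
      (fun _ ↦ (1 : ℤ)) (fun _ ↦ (-1 : ℤ))) :
    ∃ (lam : HeckeCharacter K) (rlam : FramedGaloisRep K (PadicAlgCl 3) 1),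
      lam.IsUnitary ∧ lam.HasInfinityType (fun _ ↦ (1 : ℤ)) (fun _ ↦ (-1 : ℤ)) ∧
      (∀ x : ideleGroup ℚ, lam (AdeleRing.ideleBaseChange ℚ K x) = 1) ∧
      (∀ v : HeightOneSpectrum (𝓞 K), ((3 : ℕ) : 𝓞 K) ∉ v.asIdeal → lam.IsUnramifiedAt v) ∧
      IsPAdicAvatarOf ι lam rlam ∧ FactorsThroughZp κ rlam := by
  classical
  haveI : Algebra.IsQuadraticExtension ℚ K := { finrank_eq_two' := hK }
  haveI : IsGalois ℚ K := inferInstance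
  -- the currency `e : ℚ̄₃ˣ ≃ GL₁(ℚ̄₃)`
  set e := (FramedRep.unitsContinuousMulEquivOfUnique (Fin 1) (PadicAlgCl 3) :
    (PadicAlgCl 3)ˣ →ₜ* GL (Fin 1) (PadicAlgCl 3)) with he
  -- Step 1: `c`, its lift `θ`, and the rank-two basis
  obtain ⟨c, hc, hc2⟩ := exists_not_mem_range_absGaloisRestrict (L := K) (Rat.castHom ℝ) himag
  have hinj := absGaloisRestrict_injective ℚ K
  have hidx : ∀ ρ ρ' : absoluteGaloisGroup ℚ, ρ ∉ Set.range (absGaloisRestrict ℚ K) →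
      ρ' ∉ Set.range (absGaloisRestrict ℚ K) → ρ⁻¹ * ρ' ∈ Set.range (absGaloisRestrict ℚ K) :=
    fun ρ ρ' hρ hρ' => inv_mul_mem_range_absGaloisRestrict hK hρ hρ'
  obtain ⟨θ, hθ⟩ := ZpExtension.IndexTwo.exists_conjHom (absGaloisRestrict ℚ K) hinj hidx c
  have hθθ : ∀ σ, θ (θ σ) = σ := ZpExtension.IndexTwo.conjHom_conjHom hinj hc2 hθ
  obtain ⟨Φ₀, Φ₁, hsurj, hspan⟩ := exists_spanningPair (p := 3) hK himag
  -- Step 2: Weil's character of `Ψ` with values in a finite `E/ℚ₃`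
  obtain ⟨E, hEfd, a, ha, haΨ⟩ := exists_weilValued ι hΨa
  haveI : CompleteSpace E := FiniteDimensional.complete ℚ_[3] E
  set ιE : (E)ˣ →* (PadicAlgCl 3)ˣ :=
    Units.map ((algebraMap E (PadicAlgCl 3) : E →+* PadicAlgCl 3) : E →* PadicAlgCl 3) with hιE
  have hιE_inj : Function.Injective ιE := fun x y hxy =>
    Units.ext (Subtype.ext (congrArg Units.val hxy))
  -- its currency `ψa` and the avatar `e ∘ ψa⁻¹` of `Ψ`
  obtain ⟨ψa, hψa⟩ := exists_unitsChar_of_continuous (p := 3) a ha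
  have hψa' : ∀ σ, ψa σ = ιE (a σ) := fun σ => Units.ext (hψa σ)
  have hΨav : IsPAdicAvatarOf ι Ψ (e.comp ψa⁻¹) := by
    rw [isPAdicAvatarOf_unitsChar_iff]
    intro v hv hu
    obtain ⟨h1, h2⟩ := haΨ v hv hu
    refine ⟨fun 𝔓 h𝔓 σ hσ => ?_, fun 𝔓 h𝔓 Φ hΦ => ?_⟩
    · rw [unitsChar_inv_apply, hψa', h1 𝔓 h𝔓 σ hσ, map_one, inv_one]
    · rw [unitsChar_inv_apply, Units.val_inv_eq_inv_val, hψa, h2 𝔓 h𝔓 Φ hΦ]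
  -- transport: `a ∘ θ` kills the inertia at `v ∤ 3` too
  have haθ : ∀ v : HeightOneSpectrum (𝓞 K), ((3 : ℕ) : 𝓞 K) ∉ v.asIdeal →
      ∀ 𝔓 ∈ v.primesAbove, ∀ σ ∈ 𝔓.inertia (absoluteGaloisGroup K), a (θ σ) = 1 := by
    intro v hv 𝔓 h𝔓 σ hσ
    have ht := isPAdicAvatarOf_galConj_comp ι hΨav hθ
    have hunr := (ht v hv (isUnramifiedAt_galConj_of_forall (p := 3) _ hΨu v hv)).1 𝔓 h𝔓 σ hσ
    rw [ContinuousMonoidHom.coe_comp, Function.comp_apply, ContinuousMonoidHom.coe_comp,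
      Function.comp_apply] at hunr
    have h2 : ψa⁻¹ (θ σ) = 1 :=
      (map_eq_one_iff e (FramedRep.unitsContinuousMulEquivOfUnique (Fin 1) (PadicAlgCl 3)).injective).mp
        hunr
    rw [unitsChar_inv_apply, inv_eq_one, hψa'] at h2
    exact hιE_inj (by rw [h2, map_one])
  -- Step 3: the set `S` (inertia at `v ∤ 3` and its `θ`-translates)
  set S : Set (absoluteGaloisGroup K) := {σ | ∃ v : HeightOneSpectrum (𝓞 K),
    ((3 : ℕ) : 𝓞 K) ∉ v.asIdeal ∧ ∃ 𝔓 ∈ v.primesAbove,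
      σ ∈ 𝔓.inertia (absoluteGaloisGroup K) ∨ θ σ ∈ 𝔓.inertia (absoluteGaloisGroup K)} with hS
  have hSθ : ∀ σ ∈ S, θ σ ∈ S := by
    rintro σ ⟨v, hv, 𝔓, h𝔓, h | h⟩
    · exact ⟨v, hv, 𝔓, h𝔓, Or.inr (by rwa [hθθ])⟩
    · exact ⟨v, hv, 𝔓, h𝔓, Or.inl h⟩
  have haS : ∀ σ ∈ S, a σ = 1 := by
    rintro σ ⟨v, hv, 𝔓, h𝔓, h | h⟩
    · exact (haΨ v hv (hΨu v hv)).1 𝔓 h𝔓 σ h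
    · rw [← hθθ σ]; exact haθ v hv 𝔓 h𝔓 _ h
  have hΦS : ∀ σ ∈ S, Φ₀ σ = 1 ∧ Φ₁ σ = 1 := by
    rintro σ ⟨v, hv, 𝔓, h𝔓, h | h⟩
    · exact ⟨zpChar_apply_eq_one_of_mem_inertia Φ₀ hv h𝔓 h,
        zpChar_apply_eq_one_of_mem_inertia Φ₁ hv h𝔓 h⟩
    · have h0 := zpChar_apply_eq_one_of_mem_inertia (Φ₀.comp θ) hv h𝔓 h
      have h1 := zpChar_apply_eq_one_of_mem_inertia (Φ₁.comp θ) hv h𝔓 h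
      rw [ContinuousMonoidHom.coe_comp, Function.comp_apply, hθθ] at h0 h1
      exact ⟨h0, h1⟩
  -- Step 4: the twists (F-I)
  obtain ⟨ω, φ', hωk, hφk, hωS, hφS, hgN, hgP⟩ :=
    PadicUnits.exists_twists θ hθθ Φ₀ Φ₁ hsurj hspan a ha S hSθ haS hΦS
  have hωc : Continuous ω := PadicUnits.continuous_of_isOpen_ker' ω hωk
  have hφc : Continuous φ' := PadicUnits.continuous_of_isOpen_ker' φ' hφk
  set u : absoluteGaloisGroup K →* (E)ˣ := a * ω⁻¹ * φ'⁻¹ with hu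
  set g : absoluteGaloisGroup K →* (E)ˣ := u * (u.comp θ.toMonoidHom)⁻¹ with hg
  have hg_apply : ∀ σ, g σ = u σ * (u (θ σ))⁻¹ := fun σ => rfl
  have hgN' : ∀ σ, Φ₀ σ = 1 → Φ₁ σ = 1 → g σ = 1 := fun σ h0 h1 => hgN σ h0 h1
  have hanti : ∀ σ, g (θ σ) = (g σ)⁻¹ := fun σ => by
    rw [hg_apply, hg_apply, hθθ, mul_inv_rev, inv_inv]
  -- Step 5: LEMMA Λ′ — `g` kills `ker κ`
  have hgκ : ∀ σ, κ σ = 1 → g σ = 1 := fun σ hσ =>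
    apply_eq_one_of_anti hK κ hκ hc hc2 hθ hsurj hspan g hgN' hanti
      {x : (E)ˣ | ‖1 - ((x : (E)ˣ) : E)‖ < 1}
      (fun x hx hxx => Units.ext (PadicUnits.eq_one_of_mul_self_eq_one (p := 3) (by decide) hx
        (by rw [← Units.val_mul, hxx, Units.val_one])))
      (fun τ _ => hgP τ) σ hσ
  -- Step 6: the finite-order Hecke characters `μ_ω`, `μ_φ′`
  obtain ⟨ψω, hψω⟩ := exists_unitsChar_of_continuous (p := 3) ω hωc
  obtain ⟨ψφ, hψφ⟩ := exists_unitsChar_of_continuous (p := 3) φ' hφc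
  have hψω' : ∀ σ, ψω σ = ιE (ω σ) := fun σ => Units.ext (hψω σ)
  have hψφ' : ∀ σ, ψφ σ = ιE (φ' σ) := fun σ => Units.ext (hψφ σ)
  have hkω : IsOpen (ψω.toMonoidHom.ker : Set (absoluteGaloisGroup K)) := by
    convert hωk using 1
    ext σ
    simp only [SetLike.mem_coe, MonoidHom.mem_ker]
    exact unitsChar_eq_one_iff hψω σ
  have hkφ : IsOpen (ψφ.toMonoidHom.ker : Set (absoluteGaloisGroup K)) := by
    convert hφk using 1
    ext σ
    simp only [SetLike.mem_coe, MonoidHom.mem_ker]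
    exact unitsChar_eq_one_iff hψφ σ
  obtain ⟨μω, hμω_fin, hμω_av, hμω_unr⟩ := exists_hecke_of_isOpen_ker ι ψω.toMonoidHom hkω
  obtain ⟨μφ, hμφ_fin, hμφ_av, hμφ_unr⟩ := exists_hecke_of_isOpen_ker ι ψφ.toMonoidHom hkφ
  have hμω_av' : IsPAdicAvatarOf ι μω (e.comp ψω) :=
    (isPAdicAvatarOf_unitsChar_iff ι μω ψω).mpr hμω_av
  have hμφ_av' : IsPAdicAvatarOf ι μφ (e.comp ψφ) :=
    (isPAdicAvatarOf_unitsChar_iff ι μφ ψφ).mpr hμφ_av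
  have hμω_u : ∀ v : HeightOneSpectrum (𝓞 K), ((3 : ℕ) : 𝓞 K) ∉ v.asIdeal →
      μω.IsUnramifiedAt v :=
    fun v hv => hμω_unr v fun 𝔓 h𝔓 σ hσ =>
      (unitsChar_eq_one_iff hψω σ).mpr (hωS σ ⟨v, hv, 𝔓, h𝔓, Or.inl hσ⟩)
  have hμφ_u : ∀ v : HeightOneSpectrum (𝓞 K), ((3 : ℕ) : 𝓞 K) ∉ v.asIdeal →
      μφ.IsUnramifiedAt v :=
    fun v hv => hμφ_unr v fun 𝔓 h𝔓 σ hσ =>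
      (unitsChar_eq_one_iff hψφ σ).mpr (hφS σ ⟨v, hv, 𝔓, h𝔓, Or.inl hσ⟩)
  -- Step 7: `Ψ′ = Ψ μ_ω μ_φ′` and its avatar `e ∘ ψ′`, `ψ′ = ψa⁻¹ ψω ψφ = ι_E ∘ u⁻¹`
  set Ψ' : HeckeCharacter K := Ψ * μω * μφ with hΨ'
  set ψ' : absoluteGaloisGroup K →ₜ* (PadicAlgCl 3)ˣ := ψa⁻¹ * ψω * ψφ with hψ'def
  have hΨ'u : ∀ v : HeightOneSpectrum (𝓞 K), ((3 : ℕ) : 𝓞 K) ∉ v.asIdeal →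
      Ψ'.IsUnramifiedAt v :=
    fun v hv => ((hΨu v hv).mul' (hμω_u v hv)).mul' (hμφ_u v hv)
  have hΨ'av : IsPAdicAvatarOf ι Ψ' (e.comp ψ') :=
    isPAdicAvatarOf_mul ι (isPAdicAvatarOf_mul ι hΨav hμω_av' (hram_of_forall hΨu hμω_u)) hμφ_av'
      (hram_of_forall (fun v hv => (hΨu v hv).mul' (hμω_u v hv)) hμφ_u)
  have hψ'_apply : ∀ τ, ψ' τ = ιE (u τ)⁻¹ := fun τ => by
    show (ψa τ)⁻¹ * ψω τ * ψφ τ = ιE (a τ * (ω τ)⁻¹ * (φ' τ)⁻¹)⁻¹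
    rw [hψa', hψω', hψφ', ← map_inv ιE, ← map_mul ιE, ← map_mul ιE]
    congr 1
    simp only [mul_inv_rev, inv_inv, mul_assoc, mul_comm, mul_left_comm]
  -- Step 8: `λ := Ψ′ (Ψ′ ∘ σ_c)⁻¹`, `r_λ := e ∘ (ψ′ (ψ′∘θ)⁻¹)`
  refine ⟨Ψ' * (HeckeCharacter.galConj σc Ψ')⁻¹, e.comp (ψ' * (ψ'.comp θ)⁻¹), ?_, ?_,
    fun x => mul_galConj_inv_ideleBaseChange σc Ψ' x,
    fun v hv => isUnramifiedAt_mul_galConj_inv_of_forall (p := 3) σc hΨ'u v hv,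
    isPAdicAvatarOf_mul_galConj_inv_of_finrank_eq_two hK ι hΨ'av hΨ'u hc hθ hσc, ?_⟩
  -- the finite-order part `μ (μ ∘ σ_c)⁻¹`, `μ = μ_ω μ_φ′`
  · have hμ : (μω * μφ).IsFiniteOrder := hμω_fin.mul hμφ_fin
    have heq : Ψ' * (HeckeCharacter.galConj σc Ψ')⁻¹ = (Ψ * (HeckeCharacter.galConj σc Ψ)⁻¹) *
        ((μω * μφ) * (HeckeCharacter.galConj σc (μω * μφ))⁻¹) := by
      rw [hΨ', mul_assoc Ψ, HeckeCharacter.galConj_mul, mul_inv, mul_mul_mul_comm]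
    rw [heq]
    exact hunit.mul (hμ.isUnitary.mul (isUnitary_galConj σc hμ.isUnitary).inv)
  · have hμ : (μω * μφ).IsFiniteOrder := hμω_fin.mul hμφ_fin
    have heq : Ψ' * (HeckeCharacter.galConj σc Ψ')⁻¹ = (Ψ * (HeckeCharacter.galConj σc Ψ)⁻¹) *
        ((μω * μφ) * (HeckeCharacter.galConj σc (μω * μφ))⁻¹) := by
      rw [hΨ', mul_assoc Ψ, HeckeCharacter.galConj_mul, mul_inv, mul_mul_mul_comm]
    rw [heq]
    have h0 := (hasInfinityType_zero_of_isFiniteOrder hμ).mul'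
      (hasInfinityType_zero_of_isFiniteOrder (isFiniteOrder_galConj σc hμ)).inv
    have h := htype.mul' h0
    simpa only [neg_zero, add_zero] using h
  -- factorisation through `κ`: `ψ′ (ψ′∘θ)⁻¹ = ι_E ∘ g⁻¹`
  · rw [factorsThroughZp_unitsChar_iff]
    intro σ hσ
    rw [ContinuousMonoidHom.mul_apply, unitsChar_inv_apply, ContinuousMonoidHom.coe_comp,
      Function.comp_apply, hψ'_apply, hψ'_apply, ← map_inv ιE, inv_inv, ← map_mul ιE,
      show (u σ)⁻¹ * u (θ σ) = (g σ)⁻¹ by rw [hg_apply, mul_inv_rev, inv_inv, mul_comm], hgκ σ hσ, inv_one,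
      map_one]

end Summit.BirchSwinnertonDyer.Rank1Residual.X11b.Three.LambdaSupply

namespace Summit.BirchSwinnertonDyer.Rank1Residual.X11b.Three

/-- **S24-a `Three.lambdaSupplyAt₃` — the λ-SUPPLY at `p = 3`, UNCONDITIONAL** (statement = the
hypothesis `hsup` of `hsiehFrameResidualAt₃_of_descent`, VERBATIM): for every `ι' : ℚ̄₃ ≃ ℂ`,
every imaginary quadratic `K` in which `3` splits and every ANTICYCLOTOMIC `ℤ₃`-extension `κ` of
`K` there is a pair `(λ, r_λ)` — `λ` a unitary Hecke character of `K` of infinity type `(1,-1)`,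
trivial on `𝕀_ℚ`, unramified outside `3`, `r_λ` its `3`-adic avatar — with `r_λ` factoring
through `κ`. (The splitting hypothesis is not used.) Proof: `LambdaSupply.exists_lambda_of_character`
with part (A)'s `Ψ` (`LambdaSupply.exists_character_quotient_type_one_three`), `K` being CM
(`IsCMField.ofCMExtension ℚ K`) with `σ_c` = complex conjugation (`restrictScalars_complexConj_ne_one`).
[cite: Weil1956, §1–§2] [cite: Greenberg1987, §2] [cite: Washington1997, §13.1] -/
theorem lambdaSupplyAt₃ :
    ∀ (ι' : PadicAlgCl 3 ≃+* ℂ) (K : Type) [Field K] [NumberField K] (κ : ZpExtension K 3),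
      IsImaginaryQuadratic K → ((Ideal.span {(3 : ℤ)}).primesOver (𝓞 K)).ncard = 2 →
      κ.IsAnticyclotomic →
      ∃ (lam : HeckeCharacter K) (rlam : FramedGaloisRep K (PadicAlgCl 3) 1),
        lam.IsUnitary ∧ lam.HasInfinityType (fun _ ↦ (1 : ℤ)) (fun _ ↦ (-1 : ℤ)) ∧
        (∀ x : ideleGroup ℚ, lam (AdeleRing.ideleBaseChange ℚ K x) = 1) ∧
        (∀ v : HeightOneSpectrum (𝓞 K), ((3 : ℕ) : 𝓞 K) ∉ v.asIdeal → lam.IsUnramifiedAt v) ∧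
        IsPAdicAvatarOf ι' lam rlam ∧ FactorsThroughZp κ rlam := by
  intro ι' K _ _ κ hK _ hκ
  haveI : IsTotallyComplex K := hK.2
  haveI : Algebra.IsQuadraticExtension ℚ K := { finrank_eq_two' := hK.1 }
  haveI : IsCMField K := IsCMField.ofCMExtension ℚ K
  obtain ⟨Ψ, hΨa, hΨu, hunit, htype⟩ := LambdaSupply.exists_character_quotient_type_one_three hK.1
  exact LambdaSupply.exists_lambda_of_character ι' κ hK.1 IsTotallyComplex.isComplex hκ
    LambdaSupply.restrictScalars_complexConj_ne_one hΨa hΨu hunit htype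

end Summit.BirchSwinnertonDyer.Rank1Residual.X11b.Three

end
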